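import Mathlib

/-!
# THE TAIL STAR INEQUALITY `P₁ ≥ 16 ⇒ 4 (1 − A)² ≤ P₁ (P₂ − 1)` (mine-3, gen 65; C-041.md §21 (az))

For a star with leaves `a₀, …, a_{n−1} ∈ [0, 1]` put `A = ∏ aᵢ`, `P₁ = ∏ (1 + aᵢ²)`, `P₂ = ∏ (1 + (1 − aᵢ)²)`.  The inequality
`(T2) P₁ ≥ 16 ⇒ 4 (1 − A)² ≤ P₁ (P₂ − 1)` (sharp constant ≈ 5.8; the one-leaf induction does not close it) is proved by the
SORTED CAUCHY–SCHWARZ ROUTE: with `bᵢ = 1 − aᵢ` and the prefix products `A_{<i} = ∏_{j<i} aⱼ`,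
`1 − A = Σᵢ bᵢ A_{<i}` (telescoping, `one_sub_prod_range_eq_sum`), so by Cauchy–Schwarz `(1 − A)² ≤ (Σ bᵢ²)·U` with
`U := Σᵢ A_{<i}²`, and `Σ bᵢ² ≤ P₂ − 1` (`sum_sq_le_prod_one_add_sq_sub_one`).  For ASCENDING leaves the prefix product is
the smallest product over any `k` indices (`prod_range_le_prod_of_monotone`), hence `C(n,k)·A_{<k}² ≤ e_k(a²)` and, with
`C(n,k) ≥ n` for `1 ≤ k ≤ n − 1` (`succ_le_choose_succ`) and `Σ_k e_k(a²) = P₁` (`Finset.prod_one_add`),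
`n·(U − 1) ≤ P₁ − 1` (`succ_mul_sum_prefix_sq_le`); so `U ≤ 1 + (P₁ − 1)/n ≤ P₁/4` for `n ≥ 5`, `P₁ ≥ 16`, while `U ≤ n ≤ 4 ≤ P₁/4`
for `n ≤ 4` (`sum_prefix_sq_le_quarter`).  The invariants are symmetric, so the general case follows by sorting the leaves
(`Tuple.sort`; `tail_star_ineq`).
-/

namespace PercRepro

namespace TreeClosure

open Finset

/-- Telescoping: `1 − ∏_{j<n} a j = Σ_{i<n} (1 − a i) ∏_{j<i} a j`. -/
theorem one_sub_prod_range_eq_sum (a : ℕ → ℝ) (n : ℕ) :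
    1 - ∏ j ∈ range n, a j = ∑ i ∈ range n, (1 - a i) * ∏ j ∈ range i, a j := by
  induction n with
  | zero => simp
  | succ n ih => rw [prod_range_succ, sum_range_succ, ← ih]; ring

/-- `Σ_{i<n} b i ^ 2 ≤ ∏_{i<n} (1 + b i ^ 2) − 1`. -/
theorem sum_sq_le_prod_one_add_sq_sub_one (b : ℕ → ℝ) (n : ℕ) :
    ∑ i ∈ range n, b i ^ 2 ≤ ∏ i ∈ range n, (1 + b i ^ 2) - 1 := by
  induction n with
  | zero => simp
  | succ n ih =>
    rw [prod_range_succ, sum_range_succ]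
    have h1 : 1 ≤ ∏ i ∈ range n, (1 + b i ^ 2) := one_le_prod (fun i _ => by nlinarith [sq_nonneg (b i)])
    nlinarith [sq_nonneg (b n), mul_nonneg (sub_nonneg.2 h1) (sq_nonneg (b n))]

/-- For a monotone nonnegative sequence the product over the first `k` indices is the smallest product over any
`k` indices. -/
theorem prod_range_le_prod_of_monotone (f : ℕ → ℝ) (hf0 : ∀ i, 0 ≤ f i) (hf : Monotone f) :
    ∀ (k : ℕ) (T : Finset ℕ), T.card = k → ∏ j ∈ range k, f j ≤ ∏ j ∈ T, f j := by
  intro k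
  induction k with
  | zero =>
    intro T hT
    rw [card_eq_zero] at hT
    simp [hT]
  | succ k ih =>
    intro T hT
    have hne : T.Nonempty := by
      rw [← card_pos, hT]
      exact Nat.succ_pos k
    have htm : T.max' hne ∈ T := max'_mem T hne
    have hk : k ≤ T.max' hne := by
      have hsub : T ⊆ range (T.max' hne + 1) := fun x hx => mem_range.2 (Nat.lt_succ_of_le (le_max' T x hx))
      have := card_le_card hsub
      rw [hT, card_range] at this
      omega
    have hcard : (T.erase (T.max' hne)).card = k := by
      rw [card_erase_of_mem htm, hT, Nat.add_sub_cancel]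
    rw [prod_range_succ, ← prod_erase_mul T f htm]
    exact mul_le_mul (ih _ hcard) (hf hk) (hf0 k) (prod_nonneg (fun j _ => hf0 j))

/-- `C(n + 1, k) ≥ n + 1` for `1 ≤ k ≤ n`. -/
theorem succ_le_choose_succ (n : ℕ) : ∀ k, 1 ≤ k → k ≤ n → n + 1 ≤ (n + 1).choose k := by
  induction n with
  | zero => intro k h1 h2; omega
  | succ n ih =>
    intro k h1 h2
    obtain ⟨k', rfl⟩ : ∃ k', k = k' + 1 := ⟨k - 1, by omega⟩
    rw [Nat.choose_succ_succ, Nat.succ_eq_add_one]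
    rcases Nat.eq_zero_or_pos k' with h0 | hpos
    · subst h0
      simp
    · rcases eq_or_lt_of_le h2 with heq | hlt
      · have hk : k' = n := by omega
        subst hk
        rw [Nat.choose_succ_self_right, Nat.choose_self]
      · have ha := ih k' hpos (by omega)
        have hb := ih (k' + 1) (by omega) (by omega)
        omega

/-- For a monotone sequence in `[0, 1]` with `n + 1` terms: `(n+1)·Σ_{i<n} (∏_{j<i+1} a j)² ≤ ∏_{j<n+1}(1 + a j²) − 1`
(the prefix product of length `k` is below every `k`-subset product, and there are `C(n+1, k) ≥ n + 1` of those). -/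
theorem succ_mul_sum_prefix_sq_le (a : ℕ → ℝ) (n : ℕ) (ha0 : ∀ i, 0 ≤ a i) (hmono : Monotone a) :
    ((n + 1 : ℕ) : ℝ) * ∑ i ∈ range n, (∏ j ∈ range (i + 1), a j) ^ 2
      ≤ ∏ j ∈ range (n + 1), (1 + a j ^ 2) - 1 := by
  have hf0 : ∀ i, 0 ≤ a i ^ 2 := fun i => sq_nonneg _
  have hfm : Monotone (fun j => a j ^ 2) := fun i j hij => pow_le_pow_left₀ (ha0 i) (hmono hij) 2
  have hexp : ∏ j ∈ range (n + 1), (1 + a j ^ 2) = ∑ T ∈ (range (n + 1)).powerset, ∏ j ∈ T, a j ^ 2 := by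
    rw [prod_one_add]
  have hdec : ∑ T ∈ (range (n + 1)).powerset, ∏ j ∈ T, a j ^ 2
      = ∑ k ∈ range (n + 2), ∑ T ∈ powersetCard k (range (n + 1)), ∏ j ∈ T, a j ^ 2 := by
    rw [powerset_card_disjiUnion, sum_disjiUnion, card_range]
  have hlevel : ∀ k ∈ range n, ((n + 1 : ℕ) : ℝ) * (∏ j ∈ range (k + 1), a j) ^ 2
      ≤ ∑ T ∈ powersetCard (k + 1) (range (n + 1)), ∏ j ∈ T, a j ^ 2 := by
    intro k hk
    rw [mem_range] at hk
    rw [← prod_pow]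
    have hc := card_nsmul_le_sum (powersetCard (k + 1) (range (n + 1))) (fun T => ∏ j ∈ T, a j ^ 2)
      (∏ j ∈ range (k + 1), a j ^ 2)
      (fun T hT => prod_range_le_prod_of_monotone (fun j => a j ^ 2) hf0 hfm (k + 1) T (mem_powersetCard.1 hT).2)
    rw [card_powersetCard, card_range, nsmul_eq_mul] at hc
    have hch : ((n + 1 : ℕ) : ℝ) ≤ ((n + 1).choose (k + 1) : ℝ) := by
      exact_mod_cast succ_le_choose_succ n (k + 1) (by omega) (by omega)
    calc ((n + 1 : ℕ) : ℝ) * ∏ j ∈ range (k + 1), a j ^ 2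
        ≤ ((n + 1).choose (k + 1) : ℝ) * ∏ j ∈ range (k + 1), a j ^ 2 :=
          mul_le_mul_of_nonneg_right hch (prod_nonneg (fun j _ => hf0 j))
      _ ≤ _ := hc
  have hsum : ((n + 1 : ℕ) : ℝ) * ∑ i ∈ range n, (∏ j ∈ range (i + 1), a j) ^ 2
      ≤ ∑ k ∈ range n, ∑ T ∈ powersetCard (k + 1) (range (n + 1)), ∏ j ∈ T, a j ^ 2 := by
    rw [mul_sum]
    exact sum_le_sum hlevel
  have hfull : ∑ k ∈ range (n + 2), ∑ T ∈ powersetCard k (range (n + 1)), ∏ j ∈ T, a j ^ 2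
      = 1 + ∑ k ∈ range n, ∑ T ∈ powersetCard (k + 1) (range (n + 1)), ∏ j ∈ T, a j ^ 2
        + ∑ T ∈ powersetCard (n + 1) (range (n + 1)), ∏ j ∈ T, a j ^ 2 := by
    rw [sum_range_succ, sum_range_succ']
    simp only [powersetCard_zero, sum_singleton, prod_empty]
    ring
  have hlast : 0 ≤ ∑ T ∈ powersetCard (n + 1) (range (n + 1)), ∏ j ∈ T, a j ^ 2 :=
    sum_nonneg (fun T _ => prod_nonneg (fun j _ => hf0 j))
  rw [hexp, hdec, hfull]
  linarith

/-- **THE PREFIX BOUND**: for a monotone sequence in `[0, 1]` with `P₁ = ∏_{j<n} (1 + a j²) ≥ 16`,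
`U = Σ_{i<n} (∏_{j<i} a j)² ≤ P₁ / 4`. -/
theorem sum_prefix_sq_le_quarter (a : ℕ → ℝ) (n : ℕ) (ha : ∀ i, 0 ≤ a i ∧ a i ≤ 1) (hmono : Monotone a)
    (hP : 16 ≤ ∏ j ∈ range n, (1 + a j ^ 2)) :
    ∑ i ∈ range n, (∏ j ∈ range i, a j) ^ 2 ≤ (∏ j ∈ range n, (1 + a j ^ 2)) / 4 := by
  have hterm : ∀ i, (∏ j ∈ range i, a j) ^ 2 ≤ 1 := fun i => by
    have h0 : 0 ≤ ∏ j ∈ range i, a j := prod_nonneg (fun j _ => (ha j).1)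
    have h1 : ∏ j ∈ range i, a j ≤ 1 := prod_le_one (fun j _ => (ha j).1) (fun j _ => (ha j).2)
    nlinarith
  rcases le_or_gt n 4 with hn | hn
  · have hle : ∑ i ∈ range n, (∏ j ∈ range i, a j) ^ 2 ≤ ∑ i ∈ range n, (1 : ℝ) :=
      sum_le_sum (fun i _ => hterm i)
    rw [sum_const, card_range, nsmul_eq_mul, mul_one] at hle
    have h4 : ((n : ℕ) : ℝ) ≤ 4 := by exact_mod_cast hn
    linarith
  · obtain ⟨n', rfl⟩ : ∃ n', n = n' + 1 := ⟨n - 1, by omega⟩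
    have hS := succ_mul_sum_prefix_sq_le a n' (fun i => (ha i).1) hmono
    have hS0 : 0 ≤ ∑ i ∈ range n', (∏ j ∈ range (i + 1), a j) ^ 2 := sum_nonneg (fun i _ => sq_nonneg _)
    have h5 : (5 : ℝ) ≤ ((n' + 1 : ℕ) : ℝ) := by exact_mod_cast hn
    rw [sum_range_succ']
    simp only [prod_range_zero, one_pow]
    nlinarith [mul_le_mul_of_nonneg_right h5 hS0]

/-- **(T2) FOR SORTED LEAVES**: a monotone sequence in `[0, 1]` with `P₁ ≥ 16` has `4 (1 − A)² ≤ P₁ (P₂ − 1)`. -/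
theorem tail_star_ineq_sorted (a : ℕ → ℝ) (n : ℕ) (ha : ∀ i, 0 ≤ a i ∧ a i ≤ 1) (hmono : Monotone a)
    (hP : 16 ≤ ∏ j ∈ range n, (1 + a j ^ 2)) :
    4 * (1 - ∏ j ∈ range n, a j) ^ 2
      ≤ (∏ j ∈ range n, (1 + a j ^ 2)) * (∏ j ∈ range n, (1 + (1 - a j) ^ 2) - 1) := by
  have hU := sum_prefix_sq_le_quarter a n ha hmono hP
  have hT := one_sub_prod_range_eq_sum a n
  have hCS := sum_mul_sq_le_sq_mul_sq (range n) (fun i => 1 - a i) (fun i => ∏ j ∈ range i, a j)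
  have hB := sum_sq_le_prod_one_add_sq_sub_one (fun i => 1 - a i) n
  have hU0 : 0 ≤ ∑ i ∈ range n, (∏ j ∈ range i, a j) ^ 2 := sum_nonneg (fun i _ => sq_nonneg _)
  have hb0 : 0 ≤ ∑ i ∈ range n, (1 - a i) ^ 2 := sum_nonneg (fun i _ => sq_nonneg _)
  have hP2 : 0 ≤ ∏ j ∈ range n, (1 + (1 - a j) ^ 2) - 1 := by
    have := one_le_prod (s := range n) (f := fun j => 1 + (1 - a j) ^ 2) (fun j _ => by nlinarith [sq_nonneg (1 - a j)])
    linarith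
  rw [hT]
  calc 4 * (∑ i ∈ range n, (1 - a i) * ∏ j ∈ range i, a j) ^ 2
      ≤ 4 * ((∑ i ∈ range n, (1 - a i) ^ 2) * ∑ i ∈ range n, (∏ j ∈ range i, a j) ^ 2) := by
        linarith [hCS]
    _ ≤ 4 * ((∏ j ∈ range n, (1 + (1 - a j) ^ 2) - 1) * ((∏ j ∈ range n, (1 + a j ^ 2)) / 4)) := by
        apply mul_le_mul_of_nonneg_left _ (by norm_num)
        exact mul_le_mul hB hU hU0 hP2
    _ = _ := by ring

/-- **THEOREM (T2), THE TAIL STAR INEQUALITY**: every star with `m + 2` leaves in `[0, 1]` and `P₁ = ∏ (1 + aᵢ²) ≥ 16`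
satisfies `4 (1 − ∏ aᵢ)² ≤ P₁ · (∏ (1 + (1 − aᵢ)²) − 1)` (the leaves sorted by `Tuple.sort`; the invariants are symmetric). -/
theorem tail_star_ineq {m : ℕ} (a : Fin (m + 2) → ℝ) (ha : ∀ i, 0 ≤ a i ∧ a i ≤ 1)
    (hP : 16 ≤ ∏ i, (1 + a i ^ 2)) :
    4 * (1 - ∏ i, a i) ^ 2 ≤ (∏ i, (1 + a i ^ 2)) * (∏ i, (1 + (1 - a i) ^ 2) - 1) := by
  have hms : Monotone (a ∘ Tuple.sort a) := Tuple.monotone_sort a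
  set b : ℕ → ℝ := fun i => if h : i < m + 2 then a (Tuple.sort a ⟨i, h⟩) else 1 with hb
  have hb01 : ∀ i, 0 ≤ b i ∧ b i ≤ 1 := fun i => by
    simp only [hb]
    split_ifs with h
    · exact ha _
    · exact ⟨zero_le_one, le_rfl⟩
  have hbm : Monotone b := by
    intro i j hij
    simp only [hb]
    split_ifs with hi hj hj
    · exact hms (show (⟨i, hi⟩ : Fin (m + 2)) ≤ ⟨j, hj⟩ from hij)
    · exact (ha _).2
    · omega
    · exact le_rfl
  have key : ∀ g : ℝ → ℝ, ∏ i ∈ range (m + 2), g (b i) = ∏ i, g (a i) := by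
    intro g
    rw [← Fin.prod_univ_eq_prod_range (fun i => g (b i)) (m + 2)]
    have hbi : ∀ i : Fin (m + 2), g (b i) = g (a (Tuple.sort a i)) := fun i => by
      simp only [hb, i.isLt, dite_true, Fin.eta]
    simp_rw [hbi]
    exact Equiv.prod_comp (Tuple.sort a) (fun i => g (a i))
  have h1 := key (fun x => x)
  have h2 := key (fun x => 1 + x ^ 2)
  have h3 := key (fun x => 1 + (1 - x) ^ 2)
  have := tail_star_ineq_sorted b (m + 2) hb01 hbm (by rw [h2]; exact hP)
  rw [h1, h2, h3] at this
  exact this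

end TreeClosure

end PercRepro
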